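import Summits.NavierStokesRegularity.FluidComputer.PalasekTowerGermHostFreeRun
import Summits.NavierStokesRegularity.FluidComputer.PalasekTowerShadowedRunFree
import Summits.NavierStokesRegularity.FluidComputer.PalasekTowerFaceNumbers

/-!
# The germ host, SHADOWED-RUN DOOR: an APPROXIMATE free run from the explicit profile with a certified
# remainder and explicit margins yields the explicit letter of the crux `EpisodeBase` — and the PRICE
# of that door at the register's numbers

Cell `ns-blowup`, seat `ns-blowup-fc-prover-3` (g9; D-0074 GROUP C «BRIDGE SUPPORT»; bears_on LADDER-NS N1,
route `PalasekTowerBreakdown`, crux `EpisodeBase` = item stmt-NavierStokesRegularity-19179, line `slot` v5: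
registered stub `stub_explicit_slice_run : ExplicitSliceRun`). LABEL: E–C typing + kernel analysis
(theorems only; no definition, no named fact, no `sorry`). WHAT THIS IS NOT: not Navier–Stokes evidence —
no approximate run meeting the letter is exhibited; the theorems say what one would give, and what it
would have to cost. Nothing about `RungG 1` or blow-up.

## Why (TARGET §10 note 2026-08-27T05:04Z: «the A3 certificate object for the base episode is a FREE
## NS run from explicit data with margins η»)

ecbridge-3 g6's free-run door (`LineGermData.exists_sliceRun_of_freeRun`, p498061) consumes an EXACT free
run with margins. A certificate delivers instead a field `w` on the window with (i) a bound `F` on its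
defect in the Oseen integral identity (or a residual force `r` of a classical pseudo-solution), (ii) a bound
`D` on `‖U − w(0)‖`, (iii) readouts of `w`. §2 is the door that consumes exactly that:
* §1 `exists_mem_segment_lt_norm_fderiv` — the strain face WITHOUT second-derivative constants
  (mean-value inequality: `A ‖x₁ − x₀‖ < ‖f x₁ − f x₀‖` ⇒ `‖Df‖ > A` somewhere on the segment);
* §2 **`LineGermData.exists_sliceRun_of_shadowedRun`** — `d : LineGermData U ρ σ₀ ε₀ c₄`; `w` on the window
  clock `[0, w₀]` (`w₀ = Host.wfirst`), `‖w‖ ≤ M`, Oseen identity (`ν = 1`) up to `‖Φ‖ ≤ F`, `‖U − w(0)‖ ≤ D`;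
  `2 (D + F) exp (36 C₀² (2M+1)² w₀) ≤ δ ≤ 1/2`; `η > 0`; the four EXPLICIT readouts of `w` — cap
  `≤ (5/3)Y₁ − η − δ`, speed `≥ Y₁ + η + δ`, FINITE-DIFFERENCE strain `(A₁ + η) ‖x₁ − x₀‖ + 2δ <
  ‖w(w₀, x₁) − w(w₀, x₀)‖`, core circulation `≥ N₁^{β−2} + η + δ · 8π/N₁` — give the ∃-statement of the
  registered stub VERBATIM (`ShadowedRun.exists_free_run_near_mildRef`, then p498061);
  `LineGermData.exists_sliceRun_of_pseudoRun`: the same from a classical pseudo-solution `(w, ϖ)` forced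
  by its residual `r`, `‖r(t)‖₂ ≤ G`, `F = 4 w₀^{1/4} G`;
* §3 **THE PRICE** (kernel arithmetic, wide rates): a reference meeting the speed face has `M ≥ Y₁`, and
  then `(M+(M+1))² w₀ > 5508` (`shadowing_exponent_gt_of_speed_face`; `> 15300` at the cap `M = (5/3)Y₁`),
  so the door asks `D + F ≤ ¼ · exp (−36 · 5508 · C₀²)` AT LEAST (`defect_le_of_door_hypothesis`), with
  `C₀ = oseenSliceConst ℝ³` a `Classical.choose` constant of the tree (no explicit value today). For scale,
  the register's own strain clock of window `0` is `A₀ w₀ = (11132/125) log 2 ∈ (61.72, 61.74)`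
  (`strainClock_window_zero_eq/bounds`). Reading: the certificate road to the base episode through
  sup-norm shadowing is PRICED, not opened — it needs an explicit and small `C₀` with residuals below
  `e^{−2·10⁵ C₀²}`, or a transfer principle sharper than Gronwall across `61.7` strain times.

References: M. Dashti, J. C. Robinson, SIAM J. Numer. Anal. 46 (2008) [cite: DashtiRobinson2008, Thm. 5];
S. I. Chernyshenko, P. Constantin, J. C. Robinson, E. S. Titi, J. Math. Phys. 48 (2007) 065204
[cite: ChernyshenkoConstantinRobinsonTiti2007, Thm. 2]; J. Leray, Acta Math. 63 (1934) §19
[cite: Leray1934, §19 (3.4)–(3.8)]; T. Tao, Anal. PDE 6 (2013) Thm. 5.4 [cite: Tao2011, Thm. 5.4 (ii)+(iv)];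
S. Palasek, arXiv:2605.13827 §3.3–§4 [cite: Palasek2026ElementaryModel, §4].
-/

noncomputable section

namespace Summit.NavierStokesRegularity.FluidComputer.PalasekTowerClayBridge.Germ

open Set Function Filter Topology InnerProductSpace Metric MeasureTheory
open scoped Topology ContDiff RealInnerProductSpace ENNReal NNReal
open Literature.Analysis Literature.Analysis.FluidPDE

/-! ## §1 The strain face by a finite difference -/

/-- **Mean-value inequality, contrapositive**: if `f` is differentiable on the segment `[x₀, x₁]` and
`A ‖x₁ − x₀‖ < ‖f x₁ − f x₀‖`, then `‖Df(x)‖ > A` at some point of the segment. (No second derivatives: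
this is how an approximate run certifies the strain floor of the exact run next to it.) [folklore] -/
theorem exists_mem_segment_lt_norm_fderiv {E F : Type*} [NormedAddCommGroup E] [NormedSpace ℝ E]
    [NormedAddCommGroup F] [NormedSpace ℝ F] {f : E → F} {x₀ x₁ : E} {A : ℝ}
    (hf : ∀ x ∈ segment ℝ x₀ x₁, DifferentiableAt ℝ f x) (hlt : A * ‖x₁ - x₀‖ < ‖f x₁ - f x₀‖) :
    ∃ x ∈ segment ℝ x₀ x₁, A < ‖fderiv ℝ f x‖ := by
  by_contra h
  push Not at h
  have hle := (convex_segment x₀ x₁).norm_image_sub_le_of_norm_fderiv_le hf h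
    (left_mem_segment ℝ x₀ x₁) (right_mem_segment ℝ x₀ x₁)
  exact absurd hlt (not_lt.2 hle)

namespace LineGermData

variable {U : EuclideanSpace ℝ (Fin 3) → EuclideanSpace ℝ (Fin 3)} {ρ σ₀ ε₀ c₄ : ℝ}
  (d : LineGermData U ρ σ₀ ε₀ c₄)
include d

/-! ## §2 THE SHADOWED-RUN DOOR -/

/-- **THE SHADOWED-RUN DOOR (explicit letter from an APPROXIMATE free run with certified remainder and
explicit margins).** Let `d : LineGermData U ρ σ₀ ε₀ c₄`. On the window clock `s = t − 1 ∈ [0, w₀]`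
(`w₀ = Host.wfirst`, `Host.τfirst = 1 + w₀`) let `w` be a field with continuous slices, jointly measurable on
the open slab, `‖w‖ ≤ M` (`M > 0`), obeying the Oseen integral identity at unit viscosity up to a remainder,
`w(s) = e^{sΔ}w(0) − B¹_0(w,w)(s) + Φ(s)` a.e. with `‖Φ(s,x)‖ ≤ F` (`F ≥ 0`), `s ∈ (0, w₀]`, and
`‖U − w(0)‖ ≤ D`. Let `δ` dominate the shadowing radius, `2 (D + F) exp (36 C₀² (M+(M+1))² w₀) ≤ δ ≤ 1/2`,
and let `η > 0`. If `w` shows the four faces with the margins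
* cap: `‖w(s,x)‖ ≤ (5/3) Y₁ − η − δ` on the window,
* speed: `Y₁ + η + δ ≤ ‖w(w₀, x)‖` for some `‖x‖ ≤ ρ`,
* strain, by a finite difference: `(A₁ + η) ‖x₁ − x₀‖ + 2δ < ‖w(w₀, x₁) − w(w₀, x₀)‖` for some
  `x₀, x₁ ∈ B̄(0, ρ)`,
* core: a `C¹` loop `γ` of speed `≤ 8π/N₁` inside `B̄(x, 1/N₁)`, `‖x‖ ≤ ρ`, with
  `N₁^{β−2} + η + δ · (8π/N₁) ≤ circulation (w w₀) γ`,
then the ∃-statement of the registered stub `ExplicitSliceRun` of the line `slot` holds. (The exact free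
run from `U` exists on the window within `δ` of `w` — `ShadowedRun.exists_free_run_near_mildRef`; its
faces carry margin `η` — §1 for the strain; then the free-run door p498061.) [cite: DashtiRobinson2008, Thm. 5]
[cite: Leray1934, §19 (3.4)–(3.8)] [cite: Palasek2026ElementaryModel, §4] -/
theorem exists_sliceRun_of_shadowedRun
    {w Φ : ℝ → EuclideanSpace ℝ (Fin 3) → EuclideanSpace ℝ (Fin 3)} {M F D δ η : ℝ}
    (hslc : ∀ s ∈ Icc 0 Host.wfirst, Continuous (w s))
    (hmeas : AEStronglyMeasurable (uncurry w)
      ((volume : Measure (ℝ × EuclideanSpace ℝ (Fin 3))).restrict (Ioo 0 Host.wfirst ×ˢ univ)))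
    (hM : 0 < M) (hbd : ∀ s ∈ Icc 0 Host.wfirst, ∀ y, ‖w s y‖ ≤ M)
    (hrep : ∀ s ∈ Ioc 0 Host.wfirst, w s =ᵐ[volume] fun x =>
      UnboundedOperators.heatExtension (w 0) (1 * s) x - oseenDuhamel 1 0 w w s x + Φ s x)
    (hF0 : 0 ≤ F) (hF : ∀ s ∈ Ioc 0 Host.wfirst, ∀ x, ‖Φ s x‖ ≤ F)
    (hD : ∀ y, ‖U y - w 0 y‖ ≤ D)
    (hδ : 2 * (D + F) *
      Real.exp (36 * oseenSliceConst (EuclideanSpace ℝ (Fin 3)) ^ 2 * (M + (M + 1)) ^ 2 / 1 * Host.wfirst) ≤ δ)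
    (hδ2 : δ ≤ 1 / 2) (hη : 0 < η)
    (hcap : ∀ s ∈ Icc 0 Host.wfirst, ∀ x, ‖w s x‖ ≤ 5 / 3 * TowerRates.wide.Y 1 - η - δ)
    (hspeed : ∃ x, ‖x‖ ≤ ρ ∧ TowerRates.wide.Y 1 + η + δ ≤ ‖w Host.wfirst x‖)
    (hstrain : ∃ x₀ x₁, ‖x₀‖ ≤ ρ ∧ ‖x₁‖ ≤ ρ ∧
      (TowerRates.wide.A 1 + η) * ‖x₁ - x₀‖ + 2 * δ < ‖w Host.wfirst x₁ - w Host.wfirst x₀‖)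
    (hcore : ∃ (x : EuclideanSpace ℝ (Fin 3)) (γ : ℝ → EuclideanSpace ℝ (Fin 3)),
      ‖x‖ ≤ ρ ∧ ContDiff ℝ 1 γ ∧ γ 0 = γ 1 ∧
      (∀ s ∈ Icc (0 : ℝ) 1, γ s ∈ closedBall x (1 / TowerRates.wide.N 1)) ∧
      (∀ s ∈ Icc (0 : ℝ) 1, ‖deriv γ s‖ ≤ 8 * Real.pi / TowerRates.wide.N 1) ∧
      TowerRates.wide.N 1 ^ (TowerRates.wide.β - 2) + η + δ * (8 * Real.pi / TowerRates.wide.N 1) ≤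
        circulation (w Host.wfirst) γ) :
    ∃ (U' : EuclideanSpace ℝ (Fin 3) → EuclideanSpace ℝ (Fin 3)) (ρ' σ₀' ε c₄' : ℝ)
      (_ : LineGermData U' ρ' σ₀' ε c₄')
      (v : ℝ → EuclideanSpace ℝ (Fin 3) → EuclideanSpace ℝ (Fin 3)) (r : ℝ → EuclideanSpace ℝ (Fin 3) → ℝ),
      IsClassicalNSSolutionOn (Icc 1 Host.τfirst) 1 (lineForce U' σ₀' ε) v r ∧ v 1 = U' ∧
      (∃ C : ℝ≥0∞, C < ⊤ ∧ ∀ t ∈ Icc (1 : ℝ) Host.τfirst, ∫⁻ x, ‖v t x‖ₑ ^ 2 ≤ C) ∧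
      (∀ t ∈ Icc (1 : ℝ) Host.τfirst, ∀ x, ‖v t x‖ ≤ 5 / 3 * TowerRates.wide.Y 1) ∧
      (∃ x, ‖x‖ ≤ ρ' ∧ TowerRates.wide.Y 1 ≤ ‖v Host.τfirst x‖) ∧
      (∃ x, ‖x‖ ≤ ρ' ∧ TowerRates.wide.A 1 ≤ ‖fderiv ℝ (v Host.τfirst) x‖) ∧
      (∃ (x : EuclideanSpace ℝ (Fin 3)) (γ : ℝ → EuclideanSpace ℝ (Fin 3)),
        ‖x‖ ≤ ρ' ∧ ContDiff ℝ 1 γ ∧ γ 0 = γ 1 ∧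
        (∀ s ∈ Icc (0 : ℝ) 1, γ s ∈ closedBall x (1 / TowerRates.wide.N 1)) ∧
        (∀ s ∈ Icc (0 : ℝ) 1, ‖deriv γ s‖ ≤ 8 * Real.pi / TowerRates.wide.N 1) ∧
        TowerRates.wide.N 1 ^ (TowerRates.wide.β - 2) ≤ circulation (v Host.τfirst) γ) := by
  -- ### the window `[0, W]`, the datum `U`
  set W : ℝ := Host.wfirst with hW_def
  have hW : 0 < W := Host.wfirst_pos
  have hτ : Host.τfirst = 1 + W := Host.τfirst_eq
  have hU0 : HasRapidSpatialDecay U := HasRapidSpatialDecay.of_hasCompactSupport d.smooth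
    ((isCompact_closedBall (0 : EuclideanSpace ℝ (Fin 3)) ρ).of_isClosed_subset (isClosed_tsupport U)
      d.support)
  -- ### THE SHADOWED FREE RUN on `[0, W]` from `U`
  have hΨ : 2 * (D + F) *
      Real.exp (36 * oseenSliceConst (EuclideanSpace ℝ (Fin 3)) ^ 2 * (M + (M + 1)) ^ 2 / 1 * W) ≤ 1 / 2 :=
    hδ.trans hδ2
  obtain ⟨u', p', hcl', hu'0, hE', hclose⟩ :=
    ShadowedRun.exists_free_run_near_mildRef one_pos hW hslc hmeas hM hbd hrep hF0 hF d.smooth d.divFree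
      hU0 hD hΨ
  -- closeness `≤ δ` on the whole window
  set C₀ : ℝ := oseenSliceConst (EuclideanSpace ℝ (Fin 3)) with hC₀
  set lam : ℝ := 36 * C₀ ^ 2 * (M + (M + 1)) ^ 2 / 1 with hlam_def
  have hlam0 : 0 ≤ lam := by positivity
  have hclose' : ∀ s ∈ Icc 0 W, ∀ x, ‖u' s x - w s x‖ ≤ δ := by
    intro s hs x
    refine (hclose s hs x).trans (le_trans ?_ hδ)
    have hDF : 0 ≤ 2 * (D + F) := by
      have hD0 : 0 ≤ D := (norm_nonneg _).trans (hD 0)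
      positivity
    have h1 : Real.exp (lam * s) ≤ Real.exp (lam * W) :=
      Real.exp_le_exp.2 (mul_le_mul_of_nonneg_left hs.2 hlam0)
    exact mul_le_mul_of_nonneg_left h1 hDF
  -- ### shift to `[1, τfirst]`: `v t = u' (t − 1)`
  set v : ℝ → EuclideanSpace ℝ (Fin 3) → EuclideanSpace ℝ (Fin 3) := fun t => u' (t + -1) with hv_def
  set q : ℝ → EuclideanSpace ℝ (Fin 3) → ℝ := fun t => p' (t + -1) with hq_def
  have hmemI : ∀ {t : ℝ}, t ∈ Icc (1 : ℝ) Host.τfirst → t + -1 ∈ Icc 0 W := fun ht =>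
    ⟨by linarith [ht.1], by rw [hτ] at ht; linarith [ht.2]⟩
  have hvsol : IsClassicalNSSolutionOn (Icc 1 Host.τfirst) 1 0 v q := by
    have h1 : IsClassicalNSSolutionOn (Icc 1 Host.τfirst) 1
        (fun t => (0 : ℝ → EuclideanSpace ℝ (Fin 3) → EuclideanSpace ℝ (Fin 3)) (t + -1)) v q :=
      (hcl'.comp_add_right (-1)).mono (fun t ht => hmemI ht) (uniqueDiffOn_Icc (by rw [hτ]; linarith))
    exact h1.congr_force fun t _ x => rfl
  have hv1 : v 1 = U := by
    show u' (1 + -1) = U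
    rw [add_neg_cancel, hu'0]
  have hvE : ∃ C : ℝ≥0∞, C < ⊤ ∧ ∀ t ∈ Icc (1 : ℝ) Host.τfirst, ∫⁻ x, ‖v t x‖ₑ ^ 2 ≤ C := by
    obtain ⟨C, hC, hb⟩ := hE'
    exact ⟨C, hC, fun t ht => hb (t + -1) (hmemI ht)⟩
  have hvτ : v Host.τfirst = u' W := by
    show u' (Host.τfirst + -1) = u' W
    rw [hτ]; ring_nf
  have hWmem : W ∈ Icc 0 W := ⟨hW.le, le_rfl⟩
  -- ### the four faces of the exact run, with margin `η`
  -- the cap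
  have hcap' : ∀ t ∈ Icc (1 : ℝ) Host.τfirst, ∀ x, ‖v t x‖ ≤ 5 / 3 * TowerRates.wide.Y 1 - η := by
    intro t ht x
    have h1 := hclose' (t + -1) (hmemI ht) x
    have h2 := hcap (t + -1) (hmemI ht) x
    calc ‖v t x‖ = ‖w (t + -1) x + (u' (t + -1) x - w (t + -1) x)‖ := by rw [add_sub_cancel]
      _ ≤ ‖w (t + -1) x‖ + ‖u' (t + -1) x - w (t + -1) x‖ := norm_add_le _ _
      _ ≤ 5 / 3 * TowerRates.wide.Y 1 - η := by linarith
  -- the speed floor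
  have hspeed' : ∃ x, ‖x‖ ≤ ρ ∧ TowerRates.wide.Y 1 + η ≤ ‖v Host.τfirst x‖ := by
    obtain ⟨x, hx, hfl⟩ := hspeed
    refine ⟨x, hx, ?_⟩
    have h1 := hclose' W hWmem x
    rw [hvτ]
    have h2 : ‖w W x‖ ≤ ‖u' W x‖ + ‖u' W x - w W x‖ := by
      calc ‖w W x‖ = ‖u' W x - (u' W x - w W x)‖ := by rw [sub_sub_cancel]
        _ ≤ ‖u' W x‖ + ‖u' W x - w W x‖ := norm_sub_le _ _
    have h3 : TowerRates.wide.Y 1 + η + δ ≤ ‖w W x‖ := hfl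
    linarith
  -- the strain floor, by the finite difference and §1
  have hstrain' : ∃ x, ‖x‖ ≤ ρ ∧ TowerRates.wide.A 1 + η ≤ ‖fderiv ℝ (v Host.τfirst) x‖ := by
    obtain ⟨x₀, x₁, hx₀, hx₁, hfd⟩ := hstrain
    have h0 := hclose' W hWmem x₀
    have h1 := hclose' W hWmem x₁
    -- the exact run's finite difference exceeds `(A₁ + η) ‖x₁ − x₀‖`
    have hsplit : ‖w W x₁ - w W x₀‖ ≤ ‖u' W x₁ - u' W x₀‖ + (‖u' W x₁ - w W x₁‖ + ‖u' W x₀ - w W x₀‖) := by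
      have hid : w W x₁ - w W x₀ = (u' W x₁ - u' W x₀) - ((u' W x₁ - w W x₁) - (u' W x₀ - w W x₀)) := by
        abel
      rw [hid]
      exact (norm_sub_le _ _).trans (add_le_add le_rfl (norm_sub_le _ _))
    have hlt : (TowerRates.wide.A 1 + η) * ‖x₁ - x₀‖ < ‖u' W x₁ - u' W x₀‖ := by
      have : (TowerRates.wide.A 1 + η) * ‖x₁ - x₀‖ + 2 * δ < ‖w W x₁ - w W x₀‖ := hfd
      linarith
    have hdiff : ∀ x ∈ segment ℝ x₀ x₁, DifferentiableAt ℝ (u' W) x := fun x _ =>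
      ((hcl'.contDiff_velocity hWmem).differentiable (by norm_cast)).differentiableAt
    obtain ⟨x, hxseg, hAx⟩ := exists_mem_segment_lt_norm_fderiv hdiff hlt
    have hxball : x ∈ closedBall (0 : EuclideanSpace ℝ (Fin 3)) ρ :=
      (convex_closedBall (0 : EuclideanSpace ℝ (Fin 3)) ρ).segment_subset
        (mem_closedBall_zero_iff.2 hx₀) (mem_closedBall_zero_iff.2 hx₁) hxseg
    refine ⟨x, mem_closedBall_zero_iff.1 hxball, ?_⟩
    rw [hvτ]
    exact hAx.le
  -- the core loop
  have hcore' : ∃ (x : EuclideanSpace ℝ (Fin 3)) (γ : ℝ → EuclideanSpace ℝ (Fin 3)),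
      ‖x‖ ≤ ρ ∧ ContDiff ℝ 1 γ ∧ γ 0 = γ 1 ∧
      (∀ s ∈ Icc (0 : ℝ) 1, γ s ∈ closedBall x (1 / TowerRates.wide.N 1)) ∧
      (∀ s ∈ Icc (0 : ℝ) 1, ‖deriv γ s‖ ≤ 8 * Real.pi / TowerRates.wide.N 1) ∧
      TowerRates.wide.N 1 ^ (TowerRates.wide.β - 2) + η ≤ circulation (v Host.τfirst) γ := by
    obtain ⟨x, γ, hx, hγ, hγ01, hγball, hγspeed, hcirc⟩ := hcore
    refine ⟨x, γ, hx, hγ, hγ01, hγball, hγspeed, ?_⟩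
    rw [hvτ]
    have hcu : Continuous (u' W) := (hcl'.contDiff_velocity hWmem).continuous
    have hcw : Continuous (w W) := hslc W hWmem
    have hnear : ∀ s ∈ Icc (0 : ℝ) 1, ‖u' W (γ s) - w W (γ s)‖ ≤ δ := fun s _ => hclose' W hWmem (γ s)
    have h1 := circulation_sub_le_of_near hcw hcu hγ hγspeed hnear
    linarith
  -- ### the free-run door
  exact d.exists_sliceRun_of_freeRun hvsol hv1 hvE hη hcap' hspeed' hstrain' hcore'

/-- **THE SHADOWED-RUN DOOR, a-posteriori form (classical pseudo-solution with its residual).** As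
`exists_sliceRun_of_shadowedRun`, with the reference a classical solution `(w, ϖ)` on the window clock
`[0, w₀]` of the system at unit viscosity FORCED BY `r` (its residual as a free run: jointly continuous,
bounded, weakly divergence-free slices, `‖r(s)‖₂ ≤ G`), of finite energy, `‖w‖ ≤ M`, `‖U − w(0)‖ ≤ D`, and
`δ ≥ 2 (D + 4 w₀^{1/4} G) exp (36 C₀² (M+(M+1))² w₀)`, `δ ≤ 1/2`: the four explicit readouts of `w` with
margins `η, δ` give the ∃-statement of `ExplicitSliceRun`. [cite: DashtiRobinson2008, Thm. 5]
[cite: ChernyshenkoConstantinRobinsonTiti2007, Thm. 2] [cite: Palasek2026ElementaryModel, §4] -/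
theorem exists_sliceRun_of_pseudoRun
    {w r : ℝ → EuclideanSpace ℝ (Fin 3) → EuclideanSpace ℝ (Fin 3)} {ϖ : ℝ → EuclideanSpace ℝ (Fin 3) → ℝ}
    {M G R D δ η : ℝ}
    (hw : IsClassicalNSSolutionOn (Icc 0 Host.wfirst) 1 r w ϖ)
    (hwE : ∃ C : ℝ≥0∞, C < ⊤ ∧ ∀ s ∈ Icc 0 Host.wfirst, ∫⁻ x, ‖w s x‖ₑ ^ 2 ≤ C)
    (hM : 0 < M) (hbd : ∀ s ∈ Icc 0 Host.wfirst, ∀ y, ‖w s y‖ ≤ M)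
    (hrc : Continuous (uncurry r)) (hR : ∀ s ∈ Icc 0 Host.wfirst, ∀ y, ‖r s y‖ ≤ R)
    (hrdiv : ∀ s ∈ Icc 0 Host.wfirst, IsWeaklyDivFree (r s))
    (hG : 0 ≤ G) (hr2 : ∀ s ∈ Icc 0 Host.wfirst, eLpNorm (r s) 2 volume ≤ ENNReal.ofReal G)
    (hD : ∀ y, ‖U y - w 0 y‖ ≤ D)
    (hδ : 2 * (D + 4 * (1 : ℝ) ^ (-(3 / 4 : ℝ)) * Host.wfirst ^ (1 / 4 : ℝ) * G) *
      Real.exp (36 * oseenSliceConst (EuclideanSpace ℝ (Fin 3)) ^ 2 * (M + (M + 1)) ^ 2 / 1 * Host.wfirst) ≤ δ)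
    (hδ2 : δ ≤ 1 / 2) (hη : 0 < η)
    (hcap : ∀ s ∈ Icc 0 Host.wfirst, ∀ x, ‖w s x‖ ≤ 5 / 3 * TowerRates.wide.Y 1 - η - δ)
    (hspeed : ∃ x, ‖x‖ ≤ ρ ∧ TowerRates.wide.Y 1 + η + δ ≤ ‖w Host.wfirst x‖)
    (hstrain : ∃ x₀ x₁, ‖x₀‖ ≤ ρ ∧ ‖x₁‖ ≤ ρ ∧
      (TowerRates.wide.A 1 + η) * ‖x₁ - x₀‖ + 2 * δ < ‖w Host.wfirst x₁ - w Host.wfirst x₀‖)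
    (hcore : ∃ (x : EuclideanSpace ℝ (Fin 3)) (γ : ℝ → EuclideanSpace ℝ (Fin 3)),
      ‖x‖ ≤ ρ ∧ ContDiff ℝ 1 γ ∧ γ 0 = γ 1 ∧
      (∀ s ∈ Icc (0 : ℝ) 1, γ s ∈ closedBall x (1 / TowerRates.wide.N 1)) ∧
      (∀ s ∈ Icc (0 : ℝ) 1, ‖deriv γ s‖ ≤ 8 * Real.pi / TowerRates.wide.N 1) ∧
      TowerRates.wide.N 1 ^ (TowerRates.wide.β - 2) + η + δ * (8 * Real.pi / TowerRates.wide.N 1) ≤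
        circulation (w Host.wfirst) γ) :
    ∃ (U' : EuclideanSpace ℝ (Fin 3) → EuclideanSpace ℝ (Fin 3)) (ρ' σ₀' ε c₄' : ℝ)
      (_ : LineGermData U' ρ' σ₀' ε c₄')
      (v : ℝ → EuclideanSpace ℝ (Fin 3) → EuclideanSpace ℝ (Fin 3)) (r : ℝ → EuclideanSpace ℝ (Fin 3) → ℝ),
      IsClassicalNSSolutionOn (Icc 1 Host.τfirst) 1 (lineForce U' σ₀' ε) v r ∧ v 1 = U' ∧
      (∃ C : ℝ≥0∞, C < ⊤ ∧ ∀ t ∈ Icc (1 : ℝ) Host.τfirst, ∫⁻ x, ‖v t x‖ₑ ^ 2 ≤ C) ∧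
      (∀ t ∈ Icc (1 : ℝ) Host.τfirst, ∀ x, ‖v t x‖ ≤ 5 / 3 * TowerRates.wide.Y 1) ∧
      (∃ x, ‖x‖ ≤ ρ' ∧ TowerRates.wide.Y 1 ≤ ‖v Host.τfirst x‖) ∧
      (∃ x, ‖x‖ ≤ ρ' ∧ TowerRates.wide.A 1 ≤ ‖fderiv ℝ (v Host.τfirst) x‖) ∧
      (∃ (x : EuclideanSpace ℝ (Fin 3)) (γ : ℝ → EuclideanSpace ℝ (Fin 3)),
        ‖x‖ ≤ ρ' ∧ ContDiff ℝ 1 γ ∧ γ 0 = γ 1 ∧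
        (∀ s ∈ Icc (0 : ℝ) 1, γ s ∈ closedBall x (1 / TowerRates.wide.N 1)) ∧
        (∀ s ∈ Icc (0 : ℝ) 1, ‖deriv γ s‖ ≤ 8 * Real.pi / TowerRates.wide.N 1) ∧
        TowerRates.wide.N 1 ^ (TowerRates.wide.β - 2) ≤ circulation (v Host.τfirst) γ) := by
  have hW : 0 < Host.wfirst := Host.wfirst_pos
  -- the pseudo-solution at the mild level: remainder = heat Duhamel integral of the residual
  set F : ℝ := 4 * (1 : ℝ) ^ (-(3 / 4 : ℝ)) * Host.wfirst ^ (1 / 4 : ℝ) * G with hF_def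
  have hF0 : 0 ≤ F := by positivity
  have hslc : ∀ s ∈ Icc 0 Host.wfirst, Continuous (w s) := fun s hs => (hw.contDiff_velocity hs).continuous
  have hmeas : AEStronglyMeasurable (uncurry w)
      ((volume : Measure (ℝ × EuclideanSpace ℝ (Fin 3))).restrict (Ioo 0 Host.wfirst ×ˢ univ)) := by
    have hcont : ContinuousOn (uncurry w) (Icc 0 Host.wfirst ×ˢ univ) := hw.smooth_velocity.continuousOn
    exact (hcont.mono (prod_mono Ioo_subset_Icc_self subset_rfl)).aestronglyMeasurable
      (measurableSet_Ioo.prod MeasurableSet.univ)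
  have hrslc : ∀ τ, Continuous (r τ) := fun τ => hrc.comp (continuous_const.prodMk continuous_id)
  have hrep : ∀ s ∈ Ioc 0 Host.wfirst, w s =ᵐ[volume] fun x =>
      UnboundedOperators.heatExtension (w 0) (1 * s) x - oseenDuhamel 1 0 w w s x +
        forceDuhamel 1 0 r s x :=
    fun s hs => hw.ae_eq_forced_oseenMild one_pos hW hrc hR hrdiv ENNReal.ofReal_ne_top hr2 hwE hM hbd hs
  have hF : ∀ s ∈ Ioc 0 Host.wfirst, ∀ x, ‖forceDuhamel 1 0 r s x‖ ≤ F := by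
    intro s hs x
    have hmem : ∀ τ ∈ Ioo 0 s, MemLp (r τ) 2 volume := fun τ hτ =>
      ⟨(hrslc τ).aestronglyMeasurable,
        (hr2 τ ⟨hτ.1.le, hτ.2.le.trans hs.2⟩).trans_lt ENNReal.ofReal_lt_top⟩
    have h2 : ∀ τ ∈ Ioo 0 s, eLpNorm (r τ) 2 volume ≤ ENNReal.ofReal G := fun τ hτ =>
      hr2 τ ⟨hτ.1.le, hτ.2.le.trans hs.2⟩
    have h1 : s ^ (1 / 4 : ℝ) ≤ Host.wfirst ^ (1 / 4 : ℝ) := Real.rpow_le_rpow hs.1.le hs.2 (by norm_num)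
    refine (norm_forceDuhamel_le_of_eLpNorm_two one_pos hs.1 hG hmem h2 x).trans ?_
    rw [hF_def]
    gcongr
  exact d.exists_sliceRun_of_shadowedRun hslc hmeas hM hbd hrep hF0 hF hD (by rw [hF_def]; exact hδ) hδ2 hη
    hcap hspeed hstrain hcore

end LineGermData

/-! ## §3 THE PRICE of the door at the register's numbers (wide rates; kernel arithmetic) -/

section Price

open TowerRates UniversalFace

/-- The first growth window of the host schedule IS the face-number window. [folklore] -/
theorem wfirst_eq_window_zero : Host.wfirst = UniversalFace.window 0 := rfl

/-- **The register's strain clock of window `0`, closed form**: `A₀ · w₀ = 4bβ log N₁ = (11132/125) log 2`.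
[cite: Palasek2026ElementaryModel, §3.3] -/
theorem strainClock_window_zero_eq : wide.A 0 * Host.wfirst = (11132 / 125) * Real.log 2 := by
  rw [wfirst_eq_window_zero, window_zero_eq]
  have hA : 0 < wide.A 0 := wide.A_pos 0
  field_simp

/-- **The register's strain clock of window `0`, in numbers**: `61.72 < A₀ w₀ < 61.74` — the first
growth window lasts `61.7` level-`0` strain times (`= 325.8` anchored viscous times = `w₀ Y₀²`).
[cite: Palasek2026ElementaryModel, §3.3] -/
theorem strainClock_window_zero_bounds :
    61.72 < wide.A 0 * Host.wfirst ∧ wide.A 0 * Host.wfirst < 61.74 := by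
  rw [strainClock_window_zero_eq]
  have hl1 := Real.log_two_gt_d9
  have hl2 := Real.log_two_lt_d9
  constructor <;> nlinarith

/-- `Y₁² w₀ > 1377` (`= (9/25) · windowCeil 0`). [folklore] -/
theorem Y_one_sq_mul_wfirst_gt : 1377 < wide.Y 1 ^ 2 * Host.wfirst := by
  obtain ⟨h1, -⟩ := windowCeil_zero_bounds
  have h : windowCeil 0 = UniversalFace.window 0 * ((5 / 3) * wide.Y (0 + 1)) ^ 2 := rfl
  rw [wfirst_eq_window_zero]
  rw [h] at h1
  norm_num at h1
  nlinarith

/-- **THE PRICE OF THE SHADOWED-RUN DOOR (speed face alone).** Any reference field meeting the speed face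
of the letter is at least `Y₁` somewhere, so its bound `M` has `Y₁ ≤ M`; then the register factor of the
door's exponent `36 C₀² (M+(M+1))² w₀` satisfies `(M+(M+1))² · w₀ > 5508`: the hypothesis
`2 (D + F) exp (36 C₀² (M+(M+1))² w₀) ≤ δ ≤ 1/2` of `exists_sliceRun_of_shadowedRun` demands a total defect
`D + F ≤ ¼ · exp (−36 · 5508 · C₀²)`, `C₀ = oseenSliceConst ℝ³`. [cite: Palasek2026ElementaryModel, §4] -/
theorem shadowing_exponent_gt_of_speed_face {M : ℝ} (hM : wide.Y 1 ≤ M) :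
    5508 < (M + (M + 1)) ^ 2 * Host.wfirst := by
  have hY : 0 < wide.Y 1 := Real.rpow_pos_of_pos (wide.N_pos 1) _
  have hw : 0 < Host.wfirst := Host.wfirst_pos
  have h1 := Y_one_sq_mul_wfirst_gt
  have h2 : 4 * wide.Y 1 ^ 2 ≤ (M + (M + 1)) ^ 2 := by nlinarith
  nlinarith

/-- **THE PRICE AT THE CAP**: with the natural bound `M = (5/3) Y₁` (the letter's running cap) the
register factor is `((5/3)Y₁ + ((5/3)Y₁ + 1))² · w₀ > 15300` (`4 · windowCeil 0`, `windowCeil 0 > 3825`).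
[cite: Palasek2026ElementaryModel, §4] -/
theorem shadowing_exponent_gt_at_cap :
    15300 < (5 / 3 * wide.Y 1 + (5 / 3 * wide.Y 1 + 1)) ^ 2 * Host.wfirst := by
  have hY : 0 < wide.Y 1 := Real.rpow_pos_of_pos (wide.N_pos 1) _
  have hw : 0 < Host.wfirst := Host.wfirst_pos
  obtain ⟨h1, -⟩ := windowCeil_zero_bounds
  have h : windowCeil 0 = UniversalFace.window 0 * ((5 / 3) * wide.Y (0 + 1)) ^ 2 := rfl
  rw [h, ← wfirst_eq_window_zero] at h1
  norm_num at h1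
  have h2 : 4 * (5 / 3 * wide.Y 1) ^ 2 ≤ (5 / 3 * wide.Y 1 + (5 / 3 * wide.Y 1 + 1)) ^ 2 := by nlinarith
  nlinarith

/-- **The smallness hypothesis of the door, priced**: if a reference with `Y₁ ≤ M` satisfies the door's
smallness hypothesis with some `δ ≤ 1/2`, then `2 (D + F) · exp (36 · C₀² · 5508) ≤ 1/2` — the total defect
of the certificate is at most `¼ e^{−198288 C₀²}`. [cite: Palasek2026ElementaryModel, §4] -/
theorem defect_le_of_door_hypothesis {M D F δ : ℝ} (hM : wide.Y 1 ≤ M) (hDF : 0 ≤ D + F)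
    (hδ : 2 * (D + F) *
      Real.exp (36 * oseenSliceConst (EuclideanSpace ℝ (Fin 3)) ^ 2 * (M + (M + 1)) ^ 2 / 1 * Host.wfirst) ≤ δ)
    (hδ2 : δ ≤ 1 / 2) :
    2 * (D + F) * Real.exp (36 * oseenSliceConst (EuclideanSpace ℝ (Fin 3)) ^ 2 * 5508) ≤ 1 / 2 := by
  have hC₀ : 0 < oseenSliceConst (EuclideanSpace ℝ (Fin 3)) := oseenSliceConst_pos
  have h1 := shadowing_exponent_gt_of_speed_face hM
  have hexp : Real.exp (36 * oseenSliceConst (EuclideanSpace ℝ (Fin 3)) ^ 2 * 5508) ≤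
      Real.exp (36 * oseenSliceConst (EuclideanSpace ℝ (Fin 3)) ^ 2 * (M + (M + 1)) ^ 2 / 1 * Host.wfirst) := by
    refine Real.exp_le_exp.2 ?_
    rw [div_one, mul_assoc (36 * oseenSliceConst (EuclideanSpace ℝ (Fin 3)) ^ 2)]
    exact mul_le_mul_of_nonneg_left h1.le (by positivity)
  exact ((mul_le_mul_of_nonneg_left hexp (by positivity)).trans hδ).trans hδ2

end Price

end Summit.NavierStokesRegularity.FluidComputer.PalasekTowerClayBridge.Germ

end
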